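import Mathlib.Topology.Connected.PathConnected
import Literature.Probability.RandomPlanarGeometry.ChordalCurveFamily
import HarnessLib

/-!
# Kemppainen–Smirnov's crossing conditions G1 / G2 for laws of random planar curves

Topic `Literature/Probability/RandomPlanarGeometry`; definition request `defn-ConditionG2`
(consumer: the named fact Kemppainen–Smirnov 2017, Thm 1.5, item `wi-04958`; route
SAWParafermion r5).

Source: A. Kemppainen, S. Smirnov, *Random curves, scaling limits and Loewner evolutions*,
Ann. Probab. 45 (2017) 698–779 (arXiv:1212.6215): §1.1 eq. (2) (annuli), Definition 1.1
(crossings), eq. (3) and Definition 2.3 (the avoidable set `A^u`, `A^u_τ`), Condition G1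
(eq. (4)), §2.1.3 Condition G2 (eq. (16)); Lemma 2.1 / Remark 2.2 (hitting times of closed sets
are stopping times, and "the stopping times we need in the proof of the main theorem are always
explicitly of this type"); Corollary 2.7 (the constant `1/2` is arbitrary in `(0, 1)`).

## Contents (namespace `Literature`)

* `planarAnnulus z₀ r R = A(z₀, r, R) = {r < |z - z₀| < R}` (KS (2)).
* `Curve.MakesCrossingIn γ z₀ r R S` — `γ` has a sub-curve `γ|[s,t]` which is a crossing of
  `A(z₀, r, R)` (Def. 1.1: end points outside `A`, in different components of `ℂ ∖ A`, i.e. one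
  in `|z - z₀| ≤ r`, the other in `|z - z₀| ≥ R`) whose interior `γ(s, t)` lies in `A ∩ S`
  ("a crossing of `A` which is contained in `S`"); `CurveClass.crossingIn` — the corresponding
  set of curve classes (some representative crosses; representative independence is folklore,
  as for `CurveClass.stopAt`).
* `Disconnects V C w b` — "`C` disconnects some neighborhood of `w` from some neighborhood of `b`
  in `V`" (Def. 2.3).
* `unforcedPart U b past z₀ r R = A^u_τ` (Def. 2.3, (15)) for the domain `U`, target `b` and
  explored initial piece `past = γ[0, τ]` (tip `γ(τ) = past.target`, `U_τ = U ∖ γ[0, τ]`);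
  `unforcedPartZero U a b z₀ r R = A^u` (eq. (3), time zero).
* `unforcedCrossingEvent U b F z₀ r R` — the event "`γ[τ_F, 1]` makes a crossing of `A` contained
  in `A^u_{τ_F}`", `τ_F` the first hitting time of the closed set `F`
  (`CurveClass.stopAt / startFrom`).
* `MarkedLaw` — an element `(U, a, b, P)` of a family `Σ` (KS's pair `(φ, P)`, with
  `(U, a, b) = (U(φ), φ⁻¹(-1), φ⁻¹(1))`; the uniformising map itself is not needed to STATE G2).
* `ConditionG1 fam`, **`ConditionG2 fam`** — the conditions, `fam : Set MarkedLaw`.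

## Design choices and wording risks

* CONDITIONING WITHOUT KERNELS. (16) reads `P(E ∣ γ[0, τ]) < 1/2` with the event
  `E = {γ[τ,1] crosses A inside A^u_τ}` itself depending on `γ[0, τ]`. For the hitting time `τ_F`
  of a closed set `F` (Lemma 2.1) the past is `stopAt F γ` and the future `startFrom F γ`; the
  conditional bound is stated in integrated form: for every measurable `S`,
  `P({stopAt F ∈ S} ∩ E) ≤ ½ · P{stopAt F ∈ S}` — equivalent to `P(E ∣ σ(stopAt F)) ≤ ½` a.s.
* ONLY HITTING TIMES. G2 quantifies over all stopping times of a good parametrisation; we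
  quantify over first hitting times of nonempty closed sets, which by Remark 2.2 are the only
  ones the proof of Thm 1.5 uses. Formally our `ConditionG2` is implied by the printed one; a
  named fact "ConditionG2 ⇒ tightness" therefore leans on Remark 2.2 — say so in its docstring.
* `≤ 1/2` instead of `< 1/2`: immaterial by Corollary 2.7 (any constant in `(0,1)`), and `≤` is
  the form that survives integration over null sets.
* Crossings "contained in `A^u_τ`": the INTERIOR `γ(s,t)` of the crossing sub-curve lies in
  `A ∩ A^u_τ` (its end points lie on the two boundary circles, outside the open annulus).
  Orientation is free (in-to-out or out-to-in), as in Def. 1.1.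
* `A^u_τ = ∅` when `∂B(z₀, r) ∩ ∂U_τ = ∅` is encoded as a conjunct `(sphere z₀ r ∩ frontier U_τ)
  .Nonempty` in the set-builder.
* Simplicity of curves, simple connectivity of `U`, `P` being a probability measure carried by
  `X_simple(U, a, b)` are NOT part of the conditions (they are hypotheses of the theorems that
  consume them; cf. `ChordalFamily.IsChordal`, `CurveClass.simple`).
* Condition C2 (topological quadrilaterals of modulus `≥ M`) needs conformal modulus / extremal
  length, not in the tree: NOT recorded (KS Prop. 2.6: G2 ⇔ G3 ⇔ C2 ⇔ C3).
-/

noncomputable section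

open MeasureTheory Filter Topology Set

namespace Literature.Probability.RandomPlanarGeometry

/-! ### Annuli and crossings -/

/-- The open annulus `A(z₀, r, R) = {z ∈ ℂ : r < |z - z₀| < R}` (KS 2017, eq. (2)).
[cite: KemppainenSmirnov2017, §1.1 eq. (2)] -/
def planarAnnulus (z₀ : ℂ) (r R : ℝ) : Set ℂ :=
  {z | r < dist z z₀ ∧ dist z z₀ < R}

/-- Membership in `planarAnnulus`. [cite: KemppainenSmirnov2017, §1.1 eq. (2)] -/
@[simp] theorem mem_planarAnnulus {z₀ z : ℂ} {r R : ℝ} :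
    z ∈ planarAnnulus z₀ r R ↔ r < dist z z₀ ∧ dist z z₀ < R := Iff.rfl

/-- The annulus is open. [folklore] -/
theorem isOpen_planarAnnulus (z₀ : ℂ) (r R : ℝ) : IsOpen (planarAnnulus z₀ r R) :=
  (isOpen_lt continuous_const (continuous_id.dist continuous_const)).inter
    (isOpen_lt (continuous_id.dist continuous_const) continuous_const)

/-- An annulus with `R ≤ r` is empty. [folklore] -/
theorem planarAnnulus_eq_empty {z₀ : ℂ} {r R : ℝ} (h : R ≤ r) : planarAnnulus z₀ r R = ∅ :=
  Set.eq_empty_of_forall_notMem fun _ ⟨h1, h2⟩ => (lt_irrefl _) ((h1.trans h2).trans_le h)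

namespace Curve

/-- **`γ` makes a crossing of `A(z₀, r, R)` which is contained in `S`** (KS 2017, Def. 1.1 with
Def. 2.3): there are parameters `s < t` such that the sub-curve `γ|[s, t]` is a crossing of the
annulus — its end points lie outside `A` in different components of `ℂ ∖ A`, i.e. one in the
closed disc `|z - z₀| ≤ r` and the other in `|z - z₀| ≥ R` (either order) — and its interior
`γ(s, t)` lies in `A ∩ S`. [cite: KemppainenSmirnov2017, Def. 1.1] -/
def MakesCrossingIn (γ : Curve ℂ) (z₀ : ℂ) (r R : ℝ) (S : Set ℂ) : Prop :=
  ∃ s t : unitInterval, s < t ∧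
    ((dist (γ s) z₀ ≤ r ∧ R ≤ dist (γ t) z₀) ∨ (R ≤ dist (γ s) z₀ ∧ dist (γ t) z₀ ≤ r)) ∧
    ∀ u : unitInterval, s < u → u < t → γ u ∈ planarAnnulus z₀ r R ∩ S

/-- `γ` makes a crossing of `A(z₀, r, R)` (anywhere) (KS 2017, Def. 1.1).
[cite: KemppainenSmirnov2017, Def. 1.1] -/
def MakesCrossing (γ : Curve ℂ) (z₀ : ℂ) (r R : ℝ) : Prop :=
  γ.MakesCrossingIn z₀ r R univ

/-- Crossing inside `S` is monotone in `S`. [folklore] -/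
theorem MakesCrossingIn.mono {γ : Curve ℂ} {z₀ : ℂ} {r R : ℝ} {S T : Set ℂ} (hST : S ⊆ T)
    (h : γ.MakesCrossingIn z₀ r R S) : γ.MakesCrossingIn z₀ r R T := by
  obtain ⟨s, t, hst, hends, hin⟩ := h
  exact ⟨s, t, hst, hends, fun u hu hu' => ⟨(hin u hu hu').1, hST (hin u hu hu').2⟩⟩

/-- A constant curve crosses no annulus of positive modulus. [folklore] -/
theorem not_makesCrossingIn_const (x z₀ : ℂ) {r R : ℝ} (h : r < R) (S : Set ℂ) :
    ¬ (const x).MakesCrossingIn z₀ r R S := by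
  rintro ⟨s, t, -, hends, -⟩
  simp only [const_apply] at hends
  rcases hends with ⟨h1, h2⟩ | ⟨h1, h2⟩ <;> linarith

end Curve

namespace CurveClass

/-- The event "the curve makes a crossing of `A(z₀, r, R)` contained in `S`" on curves modulo
reparametrisation: some representative does (the property is invariant under reparametrisation
at distance `0`; folklore, cf. `CurveClass.stopAt_mk`). [cite: KemppainenSmirnov2017, Def. 1.1] -/
def crossingIn (z₀ : ℂ) (r R : ℝ) (S : Set ℂ) : Set (CurveClass ℂ) :=
  {c | ∃ γ : Curve ℂ, mk γ = c ∧ γ.MakesCrossingIn z₀ r R S}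

/-- Membership in `crossingIn`. [folklore] -/
theorem mem_crossingIn_iff {z₀ : ℂ} {r R : ℝ} {S : Set ℂ} {c : CurveClass ℂ} :
    c ∈ crossingIn z₀ r R S ↔ ∃ γ : Curve ℂ, mk γ = c ∧ γ.MakesCrossingIn z₀ r R S := Iff.rfl

/-- `crossingIn` is monotone in the constraint set. [folklore] -/
theorem crossingIn_mono (z₀ : ℂ) (r R : ℝ) {S T : Set ℂ} (hST : S ⊆ T) :
    crossingIn z₀ r R S ⊆ crossingIn z₀ r R T :=
  fun _ ⟨γ, hγ, h⟩ => ⟨γ, hγ, h.mono hST⟩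

/-- The class of a constant curve crosses no annulus of positive modulus. [folklore] -/
theorem mk_const_notMem_crossingIn (x z₀ : ℂ) {r R : ℝ} (h : r < R) (S : Set ℂ) :
    mk (Curve.const x) ∉ crossingIn z₀ r R S := by
  rintro ⟨γ, hγ, hcross⟩
  have : γ = Curve.const x :=
    Curve.eq_const_of_dist_eq_zero (mk_eq_mk_iff_dist_eq_zero.1 hγ)
  exact Curve.not_makesCrossingIn_const x z₀ h S (this ▸ hcross)

end CurveClass

/-! ### The avoidable ("unforced") part of an annulus -/

/-- **`C` disconnects `w` from `b` in `V`** in the sense of KS 2017, Def. 2.3: "`C` disconnects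
some neighborhood of `γ(τ)` from some neighborhood of `b` in `U_τ`" (neighbourhoods because `w`
and `b` are boundary points of `V`, Remark 2.4): there are neighbourhoods `N₁ ∋ w`, `N₂ ∋ b`
such that no two points of `N₁ ∩ (V ∖ C)` and `N₂ ∩ (V ∖ C)` are joined by a path in `V ∖ C`.
[cite: KemppainenSmirnov2017, Def. 2.3] -/
def Disconnects (V C : Set ℂ) (w b : ℂ) : Prop :=
  ∃ N₁ ∈ 𝓝 w, ∃ N₂ ∈ 𝓝 b, ∀ x ∈ N₁ ∩ (V \ C), ∀ y ∈ N₂ ∩ (V \ C), ¬ JoinedIn (V \ C) x y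

/-- **The avoidable set `A^u_τ`** (KS 2017, Def. 2.3, eq. (15)) of the annulus `A = A(z₀, r, R)`
for the domain `U` with target `b`, observed after the initial piece `past = γ[0, τ]` (tip
`γ(τ) = past.target`, remaining domain `U_τ = U ∖ γ[0, τ]`): "`A^u_τ = ∅` if
`∂B(z₀, r) ∩ ∂U_τ = ∅` and `A^u_τ = {z ∈ U_τ ∩ A :` the connected component of `z` in `U_τ ∩ A`
doesn't disconnect `γ(τ)` from `b` in `U_τ}` otherwise." A crossing of `A` inside `A^u_τ` is an
*unforced* crossing. [cite: KemppainenSmirnov2017, Def. 2.3] -/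
def unforcedPart (U : Set ℂ) (b : ℂ) (past : CurveClass ℂ) (z₀ : ℂ) (r R : ℝ) : Set ℂ :=
  {z | (Metric.sphere z₀ r ∩ frontier (U \ past.range)).Nonempty ∧
    z ∈ (U \ past.range) ∩ planarAnnulus z₀ r R ∧
    ¬ Disconnects (U \ past.range)
        (connectedComponentIn ((U \ past.range) ∩ planarAnnulus z₀ r R) z) past.target b}

/-- **The avoidable set `A^u` at time zero** (KS 2017, eq. (3)): "If `∂B(z₀, r) ∩ ∂U = ∅` define
`A^u = ∅`, otherwise `A^u = {z ∈ U ∩ A :` the connected component of `z` in `U ∩ A` doesn't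
disconnect `a` from `b` in `U}`." [cite: KemppainenSmirnov2017, §1.1 eq. (3)] -/
def unforcedPartZero (U : Set ℂ) (a b : ℂ) (z₀ : ℂ) (r R : ℝ) : Set ℂ :=
  {z | (Metric.sphere z₀ r ∩ frontier U).Nonempty ∧ z ∈ U ∩ planarAnnulus z₀ r R ∧
    ¬ Disconnects U (connectedComponentIn (U ∩ planarAnnulus z₀ r R) z) a b}

/-- `A^u_τ ⊆ U_τ ∩ A`. [cite: KemppainenSmirnov2017, Def. 2.3] -/
theorem unforcedPart_subset (U : Set ℂ) (b : ℂ) (past : CurveClass ℂ) (z₀ : ℂ) (r R : ℝ) :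
    unforcedPart U b past z₀ r R ⊆ (U \ past.range) ∩ planarAnnulus z₀ r R :=
  fun _ h => h.2.1

/-- `A^u ⊆ U ∩ A`. [cite: KemppainenSmirnov2017, §1.1 eq. (3)] -/
theorem unforcedPartZero_subset (U : Set ℂ) (a b : ℂ) (z₀ : ℂ) (r R : ℝ) :
    unforcedPartZero U a b z₀ r R ⊆ U ∩ planarAnnulus z₀ r R :=
  fun _ h => h.2.1

/-- `A^u_τ = ∅` when the inner circle misses `∂U_τ`. [cite: KemppainenSmirnov2017, Def. 2.3] -/
theorem unforcedPart_eq_empty {U : Set ℂ} {past : CurveClass ℂ} {z₀ : ℂ} {r : ℝ}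
    (h : Metric.sphere z₀ r ∩ frontier (U \ past.range) = ∅) (b : ℂ) (R : ℝ) :
    unforcedPart U b past z₀ r R = ∅ :=
  Set.eq_empty_of_forall_notMem fun _ hz => hz.1.ne_empty h

/-- **The event of an unforced crossing observed at the hitting time `τ_F`**: the future
`γ[τ_F, 1] = startFrom F γ` makes a crossing of `A(z₀, r, R)` contained in `A^u_{τ_F}`, the
avoidable set determined by the past `γ[0, τ_F] = stopAt F γ` (KS 2017, Def. 2.3: "If
`γ[τ, 1]` contains a crossing of `A` which is contained in `A^u_τ`, we say that `γ` makes an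
unforced crossing of `A` in `U_τ`"). [cite: KemppainenSmirnov2017, Def. 2.3] -/
def unforcedCrossingEvent (U : Set ℂ) (b : ℂ) (F : Set ℂ) (z₀ : ℂ) (r R : ℝ) :
    Set (CurveClass ℂ) :=
  {c | c.startFrom F ∈ CurveClass.crossingIn z₀ r R (unforcedPart U b (c.stopAt F) z₀ r R)}

/-- Membership in `unforcedCrossingEvent`. [folklore] -/
theorem mem_unforcedCrossingEvent_iff {U : Set ℂ} {b : ℂ} {F : Set ℂ} {z₀ : ℂ} {r R : ℝ}
    {c : CurveClass ℂ} :
    c ∈ unforcedCrossingEvent U b F z₀ r R ↔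
      c.startFrom F ∈ CurveClass.crossingIn z₀ r R (unforcedPart U b (c.stopAt F) z₀ r R) :=
  Iff.rfl

/-! ### Families of laws and the conditions -/

/-- An element of a Kemppainen–Smirnov family `Σ`: a domain `U` with marked boundary points
(prime ends) `a`, `b` and a law `P` on planar curves modulo reparametrisation (intended: a
probability measure carried by simple curves in `Ū` from `a` to `b`; KS encode `(U, a, b)` by a
conformal map `φ : U → 𝔻`, `a = φ⁻¹(-1)`, `b = φ⁻¹(1)`, which is not needed to state G1/G2).
[cite: KemppainenSmirnov2017, §1.1] -/
structure MarkedLaw where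
  /-- the domain `U` -/
  U : Set ℂ
  /-- the starting prime end `a` -/
  a : ℂ
  /-- the target prime end `b` -/
  b : ℂ
  /-- the law of the random curve -/
  law : Measure (CurveClass ℂ)

/-- **Condition G1** (geometric bound on an unforced crossing at time zero; KS 2017, eq. (4)):
"there exists `C > 1` such that for any `(φ, P) ∈ Σ` and for any annulus `A = A(z₀, r, R)` with
`0 < C r ≤ R`, `P(γ makes a crossing of A which is contained in A^u) ≤ 1/2`."
[cite: KemppainenSmirnov2017, Condition G1 eq. (4)] -/
def ConditionG1 (fam : Set MarkedLaw) : Prop :=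
  ∃ C : ℝ, 1 < C ∧ ∀ L ∈ fam, ∀ (z₀ : ℂ) (r R : ℝ), 0 < r → C * r ≤ R →
    L.law (CurveClass.crossingIn z₀ r R (unforcedPartZero L.U L.a L.b z₀ r R)) ≤ 2⁻¹

/-- **Condition G2** (geometric bound on an unforced crossing; KS 2017, §2.1.3 eq. (16)): "there
exists `C > 1` such that for any `(φ, P) ∈ Σ`, for any stopping time `0 ≤ τ ≤ 1` and for any
annulus `A = A(z₀, r, R)` where `0 < C r ≤ R`,
`P(γ[τ, 1] makes a crossing of A which is contained in A^u_τ ∣ γ[0, τ]) < 1/2`."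
Here: for every first hitting time `τ_F` of a nonempty closed set `F` (Lemma 2.1; by Remark 2.2
the only stopping times the proof of Thm 1.5 uses) and every measurable set `S` of pasts,
`P({stopAt F ∈ S} ∩ {unforced crossing after τ_F}) ≤ ½ · P{stopAt F ∈ S}` — the integrated
form of the conditional bound (`≤` for `<`: Corollary 2.7). See the module docstring for the
wording risks. [cite: KemppainenSmirnov2017, Condition G2 eq. (16)] -/
def ConditionG2 (fam : Set MarkedLaw) : Prop :=
  ∃ C : ℝ, 1 < C ∧ ∀ L ∈ fam, ∀ F : Set ℂ, IsClosed F → F.Nonempty →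
    ∀ (z₀ : ℂ) (r R : ℝ), 0 < r → C * r ≤ R →
      ∀ S : Set (CurveClass ℂ), MeasurableSet S →
        L.law (CurveClass.stopAt F ⁻¹' S ∩ unforcedCrossingEvent L.U L.b F z₀ r R) ≤
          2⁻¹ * L.law (CurveClass.stopAt F ⁻¹' S)

/-! ### API -/

/-- Unfolding `ConditionG2`. [folklore] -/
theorem conditionG2_iff (fam : Set MarkedLaw) :
    ConditionG2 fam ↔ ∃ C : ℝ, 1 < C ∧ ∀ L ∈ fam, ∀ F : Set ℂ, IsClosed F → F.Nonempty →
      ∀ (z₀ : ℂ) (r R : ℝ), 0 < r → C * r ≤ R →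
        ∀ S : Set (CurveClass ℂ), MeasurableSet S →
          L.law (CurveClass.stopAt F ⁻¹' S ∩ unforcedCrossingEvent L.U L.b F z₀ r R) ≤
            2⁻¹ * L.law (CurveClass.stopAt F ⁻¹' S) :=
  Iff.rfl

/-- Condition G2 passes to subfamilies (same constant `C`). [folklore] -/
theorem ConditionG2.mono {fam fam' : Set MarkedLaw} (h : ConditionG2 fam) (hsub : fam' ⊆ fam) :
    ConditionG2 fam' := by
  obtain ⟨C, hC, hfam⟩ := h
  exact ⟨C, hC, fun L hL => hfam L (hsub hL)⟩

/-- Condition G1 passes to subfamilies. [folklore] -/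
theorem ConditionG1.mono {fam fam' : Set MarkedLaw} (h : ConditionG1 fam) (hsub : fam' ⊆ fam) :
    ConditionG1 fam' := by
  obtain ⟨C, hC, hfam⟩ := h
  exact ⟨C, hC, fun L hL => hfam L (hsub hL)⟩

/-- The empty family satisfies G2. [folklore] -/
theorem conditionG2_empty : ConditionG2 ∅ :=
  ⟨2, one_lt_two, fun _ h => h.elim⟩

/-- Taking `S = univ`: under G2 the unconditional probability of an unforced crossing after
`τ_F` is at most half the total mass. [cite: KemppainenSmirnov2017, Condition G2 eq. (16)] -/
theorem ConditionG2.measure_le {fam : Set MarkedLaw} (h : ConditionG2 fam) :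
    ∃ C : ℝ, 1 < C ∧ ∀ L ∈ fam, ∀ F : Set ℂ, IsClosed F → F.Nonempty →
      ∀ (z₀ : ℂ) (r R : ℝ), 0 < r → C * r ≤ R →
        L.law (unforcedCrossingEvent L.U L.b F z₀ r R) ≤ 2⁻¹ * L.law univ := by
  obtain ⟨C, hC, hfam⟩ := h
  refine ⟨C, hC, fun L hL F hF hFn z₀ r R hr hR => ?_⟩
  simpa using hfam L hL F hF hFn z₀ r R hr hR univ MeasurableSet.univ

/-- Non-vacuity: the family of Dirac masses at constant curves (which never cross an annulus of
positive modulus) satisfies G2 with `C = 2`. [folklore] -/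
theorem conditionG2_dirac_const (fam : Set MarkedLaw)
    (h : ∀ L ∈ fam, ∃ x : ℂ, L.law = Measure.dirac (CurveClass.mk (Curve.const x))) :
    ConditionG2 fam := by
  refine ⟨2, one_lt_two, fun L hL F _ _ z₀ r R hr hR S _ => ?_⟩
  obtain ⟨x, hx⟩ := h L hL
  have hrR : r < R := by linarith
  have hnot : CurveClass.mk (Curve.const x) ∉
      CurveClass.stopAt F ⁻¹' S ∩ unforcedCrossingEvent L.U L.b F z₀ r R := by
    rintro ⟨-, hc⟩
    rw [mem_unforcedCrossingEvent_iff, CurveClass.startFrom_mk_const] at hc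
    exact CurveClass.mk_const_notMem_crossingIn x z₀ hrR _ hc
  rw [hx, Measure.dirac_apply, Set.indicator_of_notMem hnot]
  exact zero_le

end Literature.Probability.RandomPlanarGeometry
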